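import Mathlib.Analysis.Calculus.MeanValue
import Literature.Analysis.FunctionSpaces.TorusHolderBridge
import Literature.Analysis.FunctionSpaces.HolderLimitOfIncrements
import HarnessLib

/-!
# Space–time Lipschitz bounds for jointly smooth fields on `[0,T] × T^d`

Support lemma (theorem-only) for the limit steps of convex-integration schemes
(De Lellis–Kwon 2022, §2.2; Buckmaster–De Lellis–Székelyhidi–Vicol 2019, §2.2): the increments
`w = v_{q+1} - v_q` are controlled in `C⁰` and in `C¹` (all spatial partials and, through the
equation, the time derivative, cf. DLK §2.2: "`‖∂ₜv_q‖₀ ≤ ‖v_q‖₀‖Dv_q‖₀ + ‖Dp_q‖₀ + ‖DR_q‖₀`"),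
and a `C¹` bound in space *and* time is a Lipschitz bound for the product metric of `ℝ × T^d`
on `[0,T] × T^d` — the input of the interpolation `‖w‖_{C^β} ≲ ‖w‖₀^{1-β}‖w‖₁^β`
(`FunctionSpaces.holderOnSpaceTime_of_unifLimit`, `HolderLimitOfIncrements`).

* `Torus.lipschitzOnWith_uncurry_of_bounds`: if `w` is jointly smooth on `[0,T] × T^d`,
  `‖∂ᵢ w(t)‖_∞ ≤ Mᵢ` and `‖∂ₜ w‖_∞ ≤ B` on `[0,T]`, then `(t,x) ↦ w t x` is Lipschitz on
  `[0,T] × T^d` with constant `√d ∑ᵢ Mᵢ + B` (space: `Torus.lipschitzWith_of_norm_partialDeriv_le`,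
  mean value inequality along good lifts; time: mean value inequality on `[0,T]`).

## References

* C. De Lellis, H. Kwon, Anal. PDE 15 (2022) = arXiv:2006.06482, §2.2. [DelellisKwon2022]
-/

noncomputable section

open Set Function Filter
open scoped NNReal Topology

namespace Literature.Analysis.FunctionSpaces.Torus

variable {d : Type*} [Fintype d] [DecidableEq d] {Y : Type*} [NormedAddCommGroup Y]
  [NormedSpace ℝ Y]

/-- **Space–time Lipschitz bound from `C¹` bounds** (De Lellis–Kwon 2022, §2.2; BDSV 2019,
§2.2). Let `w` be jointly smooth on `[0,T] × T^d` with `‖∂ᵢ w(t) x‖ ≤ Mᵢ` and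
`‖∂ₜ w(t) x‖ ≤ B` (one-sided time derivative within `[0,T]`) for `t ∈ [0,T]`. Then the uncurried
field is Lipschitz on `[0,T] × T^d` for the product metric, with constant `√d ∑ᵢ Mᵢ + B`:
`‖w t x - w t' x'‖ ≤ ‖w t x - w t x'‖ + ‖w t x' - w t' x'‖ ≤ (√d ∑ Mᵢ) d(x,x') + B |t - t'|`.
[cite: DelellisKwon2022, §2.2] -/
theorem lipschitzOnWith_uncurry_of_bounds {T : ℝ} {w : ℝ → UnitAddTorus d → Y}
    (hw : IsSmoothSpaceTimeOn (Icc 0 T) w) {M : d → ℝ≥0}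
    (hM : ∀ i, ∀ t ∈ Icc 0 T, ∀ x, ‖partialDeriv i (w t) x‖ ≤ M i) {B : ℝ≥0}
    (hB : ∀ t ∈ Icc 0 T, ∀ x, ‖timeDerivWithin (Icc 0 T) w t x‖ ≤ B) :
    LipschitzOnWith (NNReal.sqrt (Fintype.card d) * ∑ i, M i + B) (uncurry w)
      (Icc 0 T ×ˢ univ) := by
  refine LipschitzOnWith.of_dist_le_mul fun z hz z' hz' => ?_
  obtain ⟨t, x⟩ := z
  obtain ⟨t', x'⟩ := z'
  have ht : t ∈ Icc 0 T := (mem_prod.1 hz).1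
  have ht' : t' ∈ Icc 0 T := (mem_prod.1 hz').1
  simp only [uncurry_apply_pair]
  -- space: Lipschitz slice at time `t`
  have hsp : dist (w t x) (w t x') ≤ (NNReal.sqrt (Fintype.card d) * ∑ i, M i : ℝ≥0) * dist x x' :=
    (lipschitzWith_of_norm_partialDeriv_le ((hw.isSmooth_slice ht).isContDiff (by simp))
      (fun i y => hM i t ht y)).dist_le_mul x x'
  -- time: mean value inequality on `[0,T]` for the slice at `x'`
  have htm : ‖w t' x' - w t x'‖ ≤ B * ‖t' - t‖ :=
    (convex_Icc 0 T).norm_image_sub_le_of_norm_hasDerivWithin_le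
      (fun τ hτ => hw.hasDerivWithinAt_slice hτ x') (fun τ hτ => hB τ hτ x') ht ht'
  have hdx : dist x x' ≤ dist (t, x) (t', x') := by
    rw [Prod.dist_eq]; exact le_max_right _ _
  have hdt : ‖t' - t‖ ≤ dist (t, x) (t', x') := by
    rw [Prod.dist_eq, ← dist_eq_norm, dist_comm]; exact le_max_left _ _
  calc dist (w t x) (w t' x') ≤ dist (w t x) (w t x') + dist (w t x') (w t' x') := dist_triangle _ _ _
    _ ≤ (NNReal.sqrt (Fintype.card d) * ∑ i, M i : ℝ≥0) * dist x x' + B * ‖t' - t‖ := by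
        refine add_le_add hsp ?_
        rw [dist_eq_norm, ← norm_neg, neg_sub]
        exact htm
    _ ≤ (NNReal.sqrt (Fintype.card d) * ∑ i, M i : ℝ≥0) * dist (t, x) (t', x') +
          B * dist (t, x) (t', x') := by
        gcongr
    _ = ((NNReal.sqrt (Fintype.card d) * ∑ i, M i + B : ℝ≥0) : ℝ) * dist (t, x) (t', x') := by
        push_cast; ring

/-! ### Uniform limits with Hölder regularity from summable increments -/

omit [Fintype d] [DecidableEq d] [NormedSpace ℝ Y] in
/-- **Uniform limits from summable sup increments**, in the explicit `ε`–`N` form used by the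
tree's limit lemmas: if `‖v_{n+1} - v_n‖ ≤ σ_n` on `S × T^d` with `∑ σ_n < ∞` and `Y` complete,
then some `u` satisfies `∀ ε > 0, ∃ N, ∀ q ≥ N, ‖v_q - u‖ ≤ ε` on `S × T^d`
(De Lellis–Kwon 2022, §2.2: "`{v_q}` ... is Cauchy in `C⁰`"; BDSV 2019, §2.2). [cite: DelellisKwon2022, §2.2] -/
theorem exists_unifTo_of_norm_sub_succ_le [CompleteSpace Y] {S : Set ℝ}
    {v : ℕ → ℝ → UnitAddTorus d → Y} {σ : ℕ → ℝ}
    (hσ : ∀ n, ∀ t ∈ S, ∀ x, ‖v (n + 1) t x - v n t x‖ ≤ σ n) (hs : Summable σ) :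
    ∃ u : ℝ → UnitAddTorus d → Y,
      ∀ ε > (0 : ℝ), ∃ N : ℕ, ∀ q ≥ N, ∀ t ∈ S, ∀ x, ‖v q t x - u t x‖ ≤ ε := by
  classical
  have hdist : ∀ t ∈ S, ∀ x, ∀ n, dist (v n t x) (v (n + 1) t x) ≤ σ n := fun t ht x n => by
    rw [dist_comm, dist_eq_norm]; exact hσ n t ht x
  have hc : ∀ t ∈ S, ∀ x, CauchySeq (fun n => v n t x) := fun t ht x =>
    cauchySeq_of_dist_le_of_summable σ (hdist t ht x) hs
  choose! u hu using fun t (ht : t ∈ S) x => cauchySeq_tendsto_of_complete (hc t ht x)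
  refine ⟨u, fun ε hε => ?_⟩
  -- the tails `∑_{m} σ_{n+m}` tend to zero
  have htail : Tendsto (fun n => ∑' m, σ (n + m)) atTop (𝓝 0) := by
    simpa only [add_comm] using (tendsto_sum_nat_add σ)
  obtain ⟨N, hN⟩ := (Metric.tendsto_atTop.1 htail) ε hε
  refine ⟨N, fun q hq t ht x => ?_⟩
  have h1 : dist (v q t x) (u t x) ≤ ∑' m, σ (q + m) :=
    dist_le_tsum_of_dist_le_of_tendsto σ (hdist t ht x) hs (hu t ht x) q
  have h2 : ∑' m, σ (q + m) < ε := by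
    have := hN q hq
    rw [Real.dist_0_eq_abs] at this
    exact (le_abs_self _).trans_lt this
  rw [← dist_eq_norm]
  exact h1.trans h2.le

/-- **`C⁰` convergence with `C^β` space–time regularity of the limit from summable increment
bounds** (De Lellis–Kwon 2022, §2.2, the regularity half of the proof of Thms. 1.1/1.2: from
`‖v_{q+1} - v_q‖₀ ≲ δ_{q+1}^{1/2}`, `‖v_{q+1} - v_q‖₁ ≲ λ_{q+1}δ_{q+1}^{1/2}` and the `∂ₜ` bounds,
"`{v_q}` is Cauchy in `C⁰([0,T]; C^β(T³))` ... Hence `v ∈ C^β([0,T] × T³)`"). Let `v_q` be jointly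
smooth on `[0,T] × T^d` with values in a complete space, `v₀` `β`-Hölder there (`β ≤ 1`), and let
the increments satisfy `‖v_{q+1} - v_q‖ ≤ σ_q`, `‖∂ᵢ(v_{q+1} - v_q)‖ ≤ M_{q,i}`,
`‖∂ₜ(v_{q+1} - v_q)‖ ≤ B_q` on `[0,T]`, with `∑ σ_q < ∞` and
`∑ (2σ_q)^{1-β} (√d ∑ᵢ M_{q,i} + B_q)^β < ∞`. Then `v_q → u` uniformly on `[0,T] × T^d` for some
`u ∈ C^β([0,T] × T^d)` (`FunctionSpaces.HolderOnSpaceTime β T u`). [cite: DelellisKwon2022, §2.2] -/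
theorem exists_unifTo_holderOnSpaceTime [CompleteSpace Y] {T : ℝ} {β : ℝ≥0} (hβ1 : β ≤ 1)
    {v : ℕ → ℝ → UnitAddTorus d → Y} (hv : ∀ q, IsSmoothSpaceTimeOn (Icc 0 T) (v q))
    {K₀ : ℝ} (hK₀ : 0 ≤ K₀)
    (h0 : ∀ z ∈ Icc 0 T ×ˢ (univ : Set (UnitAddTorus d)),
      ∀ z' ∈ Icc 0 T ×ˢ (univ : Set (UnitAddTorus d)),
      ‖uncurry (v 0) z - uncurry (v 0) z'‖ ≤ K₀ * dist z z' ^ (β : ℝ))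
    {σ : ℕ → ℝ} (hσ0 : ∀ n, 0 ≤ σ n)
    (hσ : ∀ n, ∀ t ∈ Icc 0 T, ∀ x, ‖v (n + 1) t x - v n t x‖ ≤ σ n) (hσs : Summable σ)
    {M : ℕ → d → ℝ≥0}
    (hM : ∀ n i, ∀ t ∈ Icc 0 T, ∀ x, ‖partialDeriv i (fun y => v (n + 1) t y - v n t y) x‖ ≤ M n i)
    {B : ℕ → ℝ≥0}
    (hB : ∀ n, ∀ t ∈ Icc 0 T, ∀ x,
      ‖timeDerivWithin (Icc 0 T) (fun s y => v (n + 1) s y - v n s y) t x‖ ≤ B n)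
    (hsum : Summable fun n => (2 * σ n) ^ (1 - (β : ℝ)) *
      ((NNReal.sqrt (Fintype.card d) * ∑ i, M n i + B n : ℝ≥0) : ℝ) ^ (β : ℝ)) :
    ∃ u : ℝ → UnitAddTorus d → Y,
      (∀ ε > (0 : ℝ), ∃ N : ℕ, ∀ q ≥ N, ∀ t ∈ Icc 0 T, ∀ x, ‖v q t x - u t x‖ ≤ ε) ∧
        HolderOnSpaceTime β T u := by
  obtain ⟨u, hu⟩ := exists_unifTo_of_norm_sub_succ_le hσ hσs
  refine ⟨u, hu, holderOnSpaceTime_of_unifLimit hβ1 hu hK₀ h0 hσ0 hσ (fun n => ?_) hsum⟩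
  have hw : IsSmoothSpaceTimeOn (Icc 0 T) (fun t x => v (n + 1) t x - v n t x) :=
    (hv (n + 1)).sub (hv n)
  exact lipschitzOnWith_uncurry_of_bounds hw (hM n) (hB n)

end Literature.Analysis.FunctionSpaces.Torus
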